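import Literature.MathematicalPhysics.QuantumManyBody.PeriodicMaxFormGroundStates
import Literature.Analysis.FunctionSpaces.LatticeSobolevRellich
import Literature.Analysis.FunctionSpaces.HaarTorusBoundedTrigApprox
import HarnessLib

/-!
# Scalar Rellich lemma `H¹ ⊂⊂ L²` on `(ℝ/ℤ)^{3N}` in sequence form (stub R of the truncation split)

Crux `TorusHalfSwapOverlap` (stmt-AtomisticToContinuum-14393), line `registered`, skeleton v7: the stub
`stub_scalarRellich` — a sequence in `L²((ℝ/ℤ)^{3N})` (Haar probability convention of
`PeriodicFormDomain.lean`) with `‖fᵢ‖ ≤ 1` and bounded spectral kinetic energy `maxFormKin L (fᵢ) ≤ K < ∞`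
has a convergent subsequence. It is the complex scalar twin of the tree's real vector-field version
`Torus.exists_strictMono_cauchySeq_of_eGradNormSq_le` (`Literature/Analysis/FunctionSpaces/TorusEnergyRellich`):
the coefficient families `cᵢ = (⟪eₙ, fᵢ⟫)ₙ` are bounded in the lattice norm `H_1`
(`‖cᵢ‖²_{H_1} = ‖fᵢ‖² + ∑ₙ |n|² |⟪eₙ, fᵢ⟫|² ≤ 1 + (L/2π)² K`, Parseval + the definition of `maxFormKin`),
`Lattice.rellich` (Warner 1983, Lemma 6.23) extracts a subsequence Cauchy in `H_0`, `H_0`-distances of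
coefficient families are `L²`-distances (Parseval), and `L²` is complete.

## References

* F. W. Warner, *Foundations of Differentiable Manifolds and Lie Groups*, GTM 94 (1983), Lemma 6.23.
  [WarnerGTM94]
* C. Foias, O. Manley, R. Rosa, R. Temam, *Navier–Stokes Equations and Turbulence*, CUP 2001, pp. 37–38
  (Rellich for periodic Sobolev spaces via Fourier coefficients).
-/

noncomputable section

namespace Summit.AtomisticToContinuum.BoseEinsteinCondensation.Cruxes.TorusHalfSwapOverlap.TruncationSplit

open MeasureTheory Filter Topology UnitAddTorus
open scoped ENNReal NNReal InnerProductSpace ComplexConjugate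
open Literature.MathematicalPhysics.QuantumManyBody.BoseGas
open Literature.Analysis.FunctionSpaces

-- The measure on `ℝ/ℤ` is the Haar PROBABILITY measure, as in `PeriodicFormDomain.lean` (so that
-- `Lp ℂ 2 (volume : Measure (UnitAddTorus (Fin N × Fin 3)))` is the space on which `maxFormKin` lives).
attribute [local instance] formDomain_measureSpace formDomain_isProbabilityMeasure formDomain_isProbabilityMeasure_pi

/-- Local notation for the Hilbert space `L²((ℝ/ℤ)^{3N})`, as in `PeriodicFormDomain.lean`. -/
local notation "L2T " N':max => Lp ℂ 2 (volume : Measure (UnitAddTorus (Fin N' × Fin 3)))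

/-- **Parseval in `ℝ≥0∞`** on `L²((ℝ/ℤ)^{3N})`: `∑ₙ ‖⟪eₙ, x⟫‖ₑ² = ‖x‖²`. [folklore] -/
theorem scalarRellich_tsum_enorm_inner_mFourierLp_sq (N : ℕ) (x : L2T N) :
    ∑' n : Fin N × Fin 3 → ℤ, ‖⟪(mFourierLp 2 n : L2T N), x⟫_ℂ‖ₑ ^ 2 = ENNReal.ofReal (‖x‖ ^ 2) := by
  have h := HaarTorus.hasSum_sq_norm_inner_mFourierLp x
  have h2 : ∀ n : Fin N × Fin 3 → ℤ, ‖⟪(mFourierLp 2 n : L2T N), x⟫_ℂ‖ₑ ^ 2 =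
      ENNReal.ofReal (‖⟪(mFourierLp 2 n : L2T N), x⟫_ℂ‖ ^ 2) := fun n => by
    rw [← ofReal_norm, ENNReal.ofReal_pow (norm_nonneg _)]
  simp_rw [h2]
  rw [← ENNReal.ofReal_tsum_of_nonneg (fun n => sq_nonneg _) h.summable, h.tsum_eq]

/-- **The `H_1` lattice norm of the coefficient family is controlled by the norm and the spectral kinetic
energy**: `‖(⟪eₙ, x⟫)ₙ‖²_{H_1} ≤ ‖x‖² + (L/2π)² · maxFormKin L x` for `x ∈ L²((ℝ/ℤ)^{3N})`, `0 < L`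
(`⟨n⟩² = 1 + |n|²`, Parseval for the first part, `|n|² = (L/2π)² ∑ₚ (2πnₚ/L)²` for the second; an identity,
stated as the inequality that is consumed). [folklore] -/
theorem scalarRellich_eNormSq_one_inner_le (N : ℕ) {L : ℝ} (hL : 0 < L) (x : L2T N) :
    Lattice.eNormSq 1 (fun n : Fin N × Fin 3 → ℤ => ⟪(mFourierLp 2 n : L2T N), x⟫_ℂ) ≤
      ENNReal.ofReal (‖x‖ ^ 2) + ENNReal.ofReal ((L / (2 * Real.pi)) ^ 2) * maxFormKin L x := by
  have hsplit : Lattice.eNormSq 1 (fun n : Fin N × Fin 3 → ℤ => ⟪(mFourierLp 2 n : L2T N), x⟫_ℂ) =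
      (∑' n : Fin N × Fin 3 → ℤ, ‖⟪(mFourierLp 2 n : L2T N), x⟫_ℂ‖ₑ ^ 2) +
        ∑' n : Fin N × Fin 3 → ℤ, ENNReal.ofReal (Torus.freqNormSq n) * ‖⟪(mFourierLp 2 n : L2T N), x⟫_ℂ‖ₑ ^ 2 := by
    rw [Lattice.eNormSq, ← ENNReal.tsum_add]
    refine tsum_congr fun n => ?_
    rw [Torus.sobolevWeight_one_sq, ENNReal.ofReal_add zero_le_one (Torus.freqNormSq_nonneg n),
      ENNReal.ofReal_one, add_mul, one_mul]
  have hkin : ∑' n : Fin N × Fin 3 → ℤ, ENNReal.ofReal (Torus.freqNormSq n) * ‖⟪(mFourierLp 2 n : L2T N), x⟫_ℂ‖ₑ ^ 2 ≤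
      ENNReal.ofReal ((L / (2 * Real.pi)) ^ 2) * maxFormKin L x := by
    rw [maxFormKin, ← ENNReal.tsum_mul_left]
    refine ENNReal.tsum_le_tsum fun n => ?_
    rw [enorm_eq_nnnorm, ← mul_assoc, ← ENNReal.ofReal_mul (sq_nonneg _)]
    gcongr
    rw [Torus.freqNormSq, Finset.mul_sum]
    refine Finset.sum_le_sum fun p _ => le_of_eq ?_
    field_simp
  rw [hsplit, scalarRellich_tsum_enorm_inner_mFourierLp_sq]
  exact add_le_add le_rfl hkin

/-- **`H_0`-distances of coefficient families are `L²`-distances**: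
`‖(⟪eₙ, x⟫)ₙ - (⟪eₙ, y⟫)ₙ‖²_{H_0} = ‖x - y‖²` (linearity of the inner product and Parseval). [folklore] -/
theorem scalarRellich_eNormSq_zero_inner_sub (N : ℕ) (x y : L2T N) :
    Lattice.eNormSq 0 ((fun n : Fin N × Fin 3 → ℤ => ⟪(mFourierLp 2 n : L2T N), x⟫_ℂ) -
        fun n : Fin N × Fin 3 → ℤ => ⟪(mFourierLp 2 n : L2T N), y⟫_ℂ) = ENNReal.ofReal (‖x - y‖ ^ 2) := by
  rw [Lattice.eNormSq, ← scalarRellich_tsum_enorm_inner_mFourierLp_sq N (x - y)]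
  refine tsum_congr fun n => ?_
  rw [Torus.sobolevWeight_zero, one_pow, ENNReal.ofReal_one, one_mul, Pi.sub_apply, inner_sub_right]

/-- **Stub R (M): scalar Rellich on `L²((ℝ/ℤ)^{3N})`, sequence form** (Warner 1983, Lemma 6.23, transported
from the lattice by Parseval): a sequence `(fᵢ)` in `L²((ℝ/ℤ)^{3N})` with `‖fᵢ‖ ≤ 1` and spectral kinetic energy
`maxFormKin L (fᵢ) ≤ K < ∞` (`0 < L`) has a convergent subsequence — the natural injection `H¹ → L²` is compact.
Proof: the coefficient families `(⟪eₙ, fᵢ⟫)ₙ` are bounded in the lattice norm `H_1` by `1 + (L/2π)² K`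
(`scalarRellich_eNormSq_one_inner_le`), `Lattice.rellich` gives a subsequence Cauchy in `H_0`, `H_0`-distances of
coefficient families are `L²`-distances (`scalarRellich_eNormSq_zero_inner_sub`), and `L²` is complete.
[cite: WarnerGTM94, Lemma 6.23] -/
theorem stub_scalarRellich :
    ∀ (N : ℕ) (L : ℝ), 0 < L → ∀ K : ℝ≥0∞, K ≠ ⊤ →
      ∀ f : ℕ → Lp ℂ 2 (volume : Measure (UnitAddTorus (Fin N × Fin 3))),
        (∀ i, ‖f i‖ ≤ 1) → (∀ i, maxFormKin L (f i) ≤ K) →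
        ∃ (η : Lp ℂ 2 (volume : Measure (UnitAddTorus (Fin N × Fin 3)))) (φ : ℕ → ℕ),
          StrictMono φ ∧ Tendsto (fun i => f (φ i)) atTop (𝓝 η) := by
  intro N L hL K hK f hf hkin
  set R : ℝ≥0∞ := 1 + ENNReal.ofReal ((L / (2 * Real.pi)) ^ 2) * K with hR
  have hRtop : R ≠ ⊤ :=
    ENNReal.add_ne_top.2 ⟨ENNReal.one_ne_top, ENNReal.mul_ne_top ENNReal.ofReal_ne_top hK⟩
  have hbound : ∀ i, Lattice.eNormSq 1 (fun n : Fin N × Fin 3 → ℤ => ⟪(mFourierLp 2 n : L2T N), f i⟫_ℂ) ≤ R := by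
    intro i
    have h1 : ENNReal.ofReal (‖f i‖ ^ 2) ≤ 1 :=
      ENNReal.ofReal_one ▸ ENNReal.ofReal_le_ofReal (pow_le_one₀ (norm_nonneg _) (hf i))
    calc Lattice.eNormSq 1 (fun n : Fin N × Fin 3 → ℤ => ⟪(mFourierLp 2 n : L2T N), f i⟫_ℂ)
        ≤ ENNReal.ofReal (‖f i‖ ^ 2) + ENNReal.ofReal ((L / (2 * Real.pi)) ^ 2) * maxFormKin L (f i) :=
          scalarRellich_eNormSq_one_inner_le N hL (f i)
      _ ≤ 1 + ENNReal.ofReal ((L / (2 * Real.pi)) ^ 2) * K := by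
          gcongr
          exact hkin i
  obtain ⟨φ, hφ, hC⟩ := Lattice.rellich (V := ℂ) (s := (0 : ℝ)) (t := 1) zero_lt_one hRtop hbound
  have hCauchy : CauchySeq (fun i => f (φ i)) := by
    refine Metric.cauchySeq_iff.2 fun ε hε => ?_
    obtain ⟨M, hM⟩ := hC (ENNReal.ofReal ((ε / 2) ^ 2)) (ENNReal.ofReal_pos.2 (by positivity))
    refine ⟨M, fun m hm n hn => ?_⟩
    have h := hM m n hm hn
    rw [scalarRellich_eNormSq_zero_inner_sub, ENNReal.ofReal_le_ofReal_iff (by positivity),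
      pow_le_pow_iff_left₀ (norm_nonneg _) (by positivity) two_ne_zero] at h
    rw [dist_eq_norm]
    linarith
  obtain ⟨η, hη⟩ := cauchySeq_tendsto_of_complete hCauchy
  exact ⟨η, φ, hφ, hη⟩

end Summit.AtomisticToContinuum.BoseEinsteinCondensation.Cruxes.TorusHalfSwapOverlap.TruncationSplit
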